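import Literature.MathematicalPhysics.QuantumLattice.TracePowerInequalities
import Literature.LinearAlgebra.Matrix.PosSemidefTrace
import Mathlib.Analysis.Matrix.Spectrum
import Mathlib.Analysis.Matrix.PosDef
import Mathlib.Algebra.Order.BigOperators.Ring.Finset
import HarnessLib

/-!
# Hilbert–Schmidt norm of matrices, positive matrices, and Kraus maps

Elementary finite-dimensional matrix analysis used by the quantum-channel estimates of
`QubitChannelFrobenius.lean` (Kempe–Regev–Unger–de Wolf, Lemma 8) and by the Pauli-expansion
proof of the noise-threshold barrier `Literature.Barriers.QuantumAdvantage.NoiseThresholdUpperBounds`: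

* `hsNormSq A = Σᵢⱼ |Aᵢⱼ|² = re Tr(A A†)` (squared Hilbert–Schmidt / Frobenius norm): unitary
  invariance `hsNormSq_unitary_conj`, `‖A + iB‖² = ‖A‖² + ‖B‖²` for Hermitian `A, B`, the
  spectral expression `Σ λⱼ²`, the Cauchy–Schwarz bound `re Tr(AB) ≤ ‖A‖_F ‖B‖_F`;
* positive semidefinite matrices: the spectral decomposition `A = Σⱼ λⱼ |uⱼ⟩⟨uⱼ|`
  (`eq_sum_eigenvalues_smul_proj`), the purity bound in `hsNormSq` form
  (`hsNormSq_le_sq_trace_of_posSemidef`, a rewrap of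
  `Literature.LinearAlgebra.Matrix.re_trace_mul_self_le_sq_of_posSemidef`) and
  `re Tr(ρσ) ≤ Tr ρ · Tr σ` (`re_trace_mul_le_of_posSemidef`; nonnegativity is
  `Literature.LinearAlgebra.Matrix.re_trace_mul_nonneg_of_posSemidef`);
* `krausMap K X = Σᵢ Kᵢ X Kᵢ†`: linearity, preservation of hermiticity and positivity, and of the
  trace when `Σᵢ Kᵢ† Kᵢ = 1` (`trace_krausMap`).

All statements are standard (Nielsen–Chuang, *Quantum Computation and Quantum Information*,
§2.1.8–2.4 and §8.2.3 for the operator-sum representation); the Kraus form is the one-qubit gate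
model of [KempeEtAl2010, §1]. Mathlib provides the spectral theorem
(`Matrix.IsHermitian.spectral_theorem`), `Matrix.PosSemidef`, `Matrix.PosSemidef.trace_nonneg`,
`Matrix.posSemidef_vecMulVec_self_star`; the tree provides the Hilbert–Schmidt Cauchy–Schwarz
inequality (`Literature.MathematicalPhysics.QuantumLattice.norm_trace_mul_le_sqrt_mul_sqrt`), the
two positive-matrix trace inequalities of `Literature/LinearAlgebra/Matrix/PosSemidefTrace.lean`
(reused here), and — in Mathlib's Frobenius-norm vocabulary, not imported —
`Matrix.frobenius_norm_sq_eq_re_trace` / unitary invariance in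
`MathematicalPhysics/QuantumLattice/YangMillsClassical.lean` and `trace_pow_eq_sum_eigenvalues_pow`
in `Computability/AlgebraicComplexity/QuantumFunctionalsDegenerationProofs.lean` (overlapping
`hsNormSq_unitary_conj`, `hsNormSq_eq_sum_sq_eigenvalues`; unification left to the librarian).
Mathlib has no partial trace / Kraus / CPTP vocabulary (`lean search 'Kraus|CPTP|partialTrace'`).

## References

* [KempeEtAl2010] J. Kempe, O. Regev, F. Unger, R. de Wolf, Quantum Inf. Comput. 10 (2010)
  361–376 (arXiv:0802.1464), §1 "Our model" and §2 (read via `lit read doi:10.26421/qic10.5-6-1`).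
-/

namespace Literature.Computability.QuantumComplexity

open Matrix Literature.MathematicalPhysics.QuantumLattice
open Literature.LinearAlgebra.Matrix (re_trace_mul_nonneg_of_posSemidef
  re_trace_mul_self_le_sq_of_posSemidef)
open scoped ComplexOrder

variable {n : Type*} [Fintype n]

/-! ### The squared Hilbert–Schmidt norm -/

section HilbertSchmidt

/-- The squared Hilbert–Schmidt (Frobenius) norm `‖A‖²_F = Σᵢⱼ |Aᵢⱼ|² = Tr(A A†)`.
[folklore] -/
noncomputable def hsNormSq (A : Matrix n n ℂ) : ℝ :=
  ∑ i, ∑ j, ‖A i j‖ ^ 2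

/-- `re Tr(A A†) = ‖A‖²_F`. [folklore] -/
theorem re_trace_mul_conjTranspose_self (A : Matrix n n ℂ) : (A * Aᴴ).trace.re = hsNormSq A :=
  trace_mul_conjTranspose_self_re A

/-- `re Tr(A† A) = ‖A‖²_F`. [folklore] -/
theorem re_trace_conjTranspose_mul_self (A : Matrix n n ℂ) : (Aᴴ * A).trace.re = hsNormSq A :=
  trace_conjTranspose_mul_self_re A

/-- `‖A‖²_F ≥ 0`. [folklore] -/
theorem hsNormSq_nonneg (A : Matrix n n ℂ) : 0 ≤ hsNormSq A :=
  Finset.sum_nonneg fun _ _ => Finset.sum_nonneg fun _ _ => by positivity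

/-- For Hermitian `A`, `‖A‖²_F = re Tr(A²)`. [folklore] -/
theorem hsNormSq_eq_re_trace_mul_self {A : Matrix n n ℂ} (hA : A.IsHermitian) :
    hsNormSq A = (A * A).trace.re := by
  rw [← re_trace_mul_conjTranspose_self, hA.eq]

/-- `‖c A‖²_F = |c|² ‖A‖²_F`. [folklore] -/
theorem hsNormSq_smul (c : ℂ) (A : Matrix n n ℂ) : hsNormSq (c • A) = ‖c‖ ^ 2 * hsNormSq A := by
  simp only [hsNormSq, Matrix.smul_apply, smul_eq_mul, norm_mul, mul_pow, Finset.mul_sum]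

/-- The Cauchy–Schwarz inequality for the Hilbert–Schmidt inner product, real-part form:
`re Tr(A B) ≤ ‖A‖_F ‖B‖_F`. [folklore] -/
theorem re_trace_mul_le (A B : Matrix n n ℂ) :
    (A * B).trace.re ≤ Real.sqrt (hsNormSq A) * Real.sqrt (hsNormSq B) := by
  have h := norm_trace_mul_le_sqrt_mul_sqrt A B
  rw [trace_mul_conjTranspose_self_re, trace_conjTranspose_mul_self_re] at h
  exact (Complex.re_le_norm _).trans h

/-- `‖A + iB‖²_F = ‖A‖²_F + ‖B‖²_F` for Hermitian `A`, `B` (the cross term `i Tr(BA − AB)`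
vanishes). [folklore] -/
theorem hsNormSq_add_I_smul {A B : Matrix n n ℂ} (hA : A.IsHermitian) (hB : B.IsHermitian) :
    hsNormSq (A + Complex.I • B) = hsNormSq A + hsNormSq B := by
  rw [← re_trace_mul_conjTranspose_self, hsNormSq_eq_re_trace_mul_self hA,
    hsNormSq_eq_re_trace_mul_self hB]
  have h1 : (A + Complex.I • B)ᴴ = A - Complex.I • B := by
    rw [conjTranspose_add, conjTranspose_smul, hA.eq, hB.eq, Complex.star_def, Complex.conj_I,
      neg_smul, sub_eq_add_neg]
  have h2 : (A + Complex.I • B) * (A - Complex.I • B) =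
      A * A + B * B + Complex.I • (B * A - A * B) := by
    rw [add_mul, mul_sub, mul_sub, smul_mul_assoc, mul_smul_comm, mul_smul_comm, smul_mul_assoc,
      smul_smul, Complex.I_mul_I, neg_one_smul, smul_sub]
    abel
  rw [h1, h2, trace_add, trace_add, trace_smul, trace_sub, trace_mul_comm B A, sub_self,
    smul_zero, add_zero, Complex.add_re]

/-- For Hermitian `A`, `B`: `|Tr(A + iB)|² = (re Tr A)² + (re Tr B)²`. [folklore] -/
theorem norm_trace_add_I_smul_sq {A B : Matrix n n ℂ} (hA : A.IsHermitian) (hB : B.IsHermitian) :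
    ‖(A + Complex.I • B).trace‖ ^ 2 = A.trace.re ^ 2 + B.trace.re ^ 2 := by
  have ha : A.trace.im = 0 := by
    have h := Matrix.trace_conjTranspose A
    rw [hA.eq, Complex.star_def] at h
    exact Complex.conj_eq_iff_im.mp h.symm
  have hb : B.trace.im = 0 := by
    have h := Matrix.trace_conjTranspose B
    rw [hB.eq, Complex.star_def] at h
    exact Complex.conj_eq_iff_im.mp h.symm
  rw [trace_add, trace_smul, smul_eq_mul, ← Complex.normSq_eq_norm_sq, Complex.normSq_apply]
  simp only [Complex.add_re, Complex.mul_re, Complex.I_re, Complex.I_im, Complex.add_im,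
    Complex.mul_im, ha, hb]
  ring

/-- For Hermitian `A`: `|Tr A|² = (re Tr A)²`. [folklore] -/
theorem norm_trace_sq_of_isHermitian {A : Matrix n n ℂ} (hA : A.IsHermitian) :
    ‖A.trace‖ ^ 2 = A.trace.re ^ 2 := by
  have h := norm_trace_add_I_smul_sq hA (isHermitian_zero (n := n) (α := ℂ))
  simpa using h

variable [DecidableEq n]

/-- Unitary invariance: `‖U A U†‖²_F = ‖A‖²_F`. [folklore] -/
theorem hsNormSq_unitary_conj {U : Matrix n n ℂ} (hU : U ∈ Matrix.unitaryGroup n ℂ)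
    (A : Matrix n n ℂ) : hsNormSq (U * A * Uᴴ) = hsNormSq A := by
  have hUU : Uᴴ * U = 1 := by
    simpa only [star_eq_conjTranspose] using Matrix.mem_unitaryGroup_iff'.mp hU
  rw [← re_trace_mul_conjTranspose_self, ← re_trace_mul_conjTranspose_self]
  have key : U * A * Uᴴ * (U * A * Uᴴ)ᴴ = U * (A * Aᴴ) * Uᴴ := by
    rw [conjTranspose_mul, conjTranspose_mul, conjTranspose_conjTranspose]
    simp only [Matrix.mul_assoc]
    rw [← Matrix.mul_assoc Uᴴ U, hUU, Matrix.one_mul]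
  rw [key, trace_mul_comm, ← Matrix.mul_assoc, hUU, Matrix.one_mul]

/-- `‖diag d‖²_F = Σ |dᵢ|²`. [folklore] -/
theorem hsNormSq_diagonal (d : n → ℂ) : hsNormSq (diagonal d) = ∑ i, ‖d i‖ ^ 2 := by
  simp only [hsNormSq, diagonal_apply]
  refine Finset.sum_congr rfl fun i _ => ?_
  rw [Finset.sum_eq_single i]
  · simp
  · intro j _ hj
    simp [Ne.symm hj]
  · simp

/-- `U diag(d) U† = Σⱼ dⱼ |uⱼ⟩⟨uⱼ|` with `uⱼ` the columns of `U`. [folklore] -/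
theorem mul_diagonal_mul_conjTranspose_eq_sum (U : Matrix n n ℂ) (d : n → ℂ) :
    U * diagonal d * Uᴴ = ∑ j, d j • vecMulVec (fun a => U a j) (star fun a => U a j) := by
  ext a b
  rw [Matrix.mul_apply, Matrix.sum_apply]
  refine Finset.sum_congr rfl fun j _ => ?_
  rw [mul_diagonal, conjTranspose_apply, Matrix.smul_apply, vecMulVec_apply, Pi.star_apply,
    smul_eq_mul]
  ring

/-- **Spectral decomposition** of a Hermitian matrix as a real combination of the rank-one
projections onto its eigenvector basis: `A = Σⱼ λⱼ |uⱼ⟩⟨uⱼ|`. [folklore] -/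
theorem eq_sum_eigenvalues_smul_proj {A : Matrix n n ℂ} (hA : A.IsHermitian) :
    A = ∑ j, (hA.eigenvalues j : ℂ) •
      vecMulVec (fun a => (hA.eigenvectorUnitary : Matrix n n ℂ) a j)
        (star fun a => (hA.eigenvectorUnitary : Matrix n n ℂ) a j) := by
  conv_lhs => rw [hA.spectral_theorem, Unitary.conjStarAlgAut_apply, star_eq_conjTranspose]
  rw [mul_diagonal_mul_conjTranspose_eq_sum]
  rfl

/-- The columns of a unitary matrix are unit vectors: `Σₐ Uₐⱼ Ūₐⱼ = 1`. [folklore] -/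
theorem dotProduct_star_col_of_mem_unitaryGroup {U : Matrix n n ℂ}
    (hU : U ∈ Matrix.unitaryGroup n ℂ) (j : n) :
    (fun a => U a j) ⬝ᵥ (star fun a => U a j) = 1 := by
  have h := Matrix.mem_unitaryGroup_iff'.mp hU
  have hjj := congrFun (congrFun h j) j
  simp only [mul_apply, star_apply, one_apply_eq] at hjj
  simp only [dotProduct, Pi.star_apply]
  rw [← hjj]
  exact Finset.sum_congr rfl fun a _ => mul_comm _ _

/-- For Hermitian `A`, `‖A‖²_F = Σⱼ λⱼ²`. [folklore] -/
theorem hsNormSq_eq_sum_sq_eigenvalues {A : Matrix n n ℂ} (hA : A.IsHermitian) :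
    hsNormSq A = ∑ j, hA.eigenvalues j ^ 2 := by
  have hU : (hA.eigenvectorUnitary : Matrix n n ℂ) ∈ Matrix.unitaryGroup n ℂ :=
    hA.eigenvectorUnitary.2
  have h := hA.spectral_theorem
  rw [Unitary.conjStarAlgAut_apply, star_eq_conjTranspose] at h
  refine (congrArg hsNormSq h).trans ?_
  rw [hsNormSq_unitary_conj hU, hsNormSq_diagonal]
  exact Finset.sum_congr rfl fun j _ => by simp [Complex.norm_real, sq_abs]

/-- **Purity bound**, `hsNormSq` form of
`Literature.LinearAlgebra.Matrix.re_trace_mul_self_le_sq_of_posSemidef`: for positive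
semidefinite `ρ`, `‖ρ‖²_F = Tr ρ² ≤ (Tr ρ)²`. [folklore] -/
theorem hsNormSq_le_sq_trace_of_posSemidef {A : Matrix n n ℂ} (hA : A.PosSemidef) :
    hsNormSq A ≤ A.trace.re ^ 2 := by
  rw [hsNormSq_eq_re_trace_mul_self hA.1]
  exact re_trace_mul_self_le_sq_of_posSemidef hA

omit [DecidableEq n] in
/-- For positive semidefinite `ρ`: `re Tr ρ ≥ 0` (real part of Mathlib's
`Matrix.PosSemidef.trace_nonneg`). [folklore] -/
theorem re_trace_nonneg_of_posSemidef {A : Matrix n n ℂ} (hA : A.PosSemidef) :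
    0 ≤ A.trace.re :=
  (Complex.nonneg_iff.1 hA.trace_nonneg).1

/-- For positive semidefinite `ρ, σ`: `re Tr(ρ σ) ≤ Tr ρ · Tr σ`. [folklore] -/
theorem re_trace_mul_le_of_posSemidef {A B : Matrix n n ℂ} (hA : A.PosSemidef)
    (hB : B.PosSemidef) : (A * B).trace.re ≤ A.trace.re * B.trace.re := by
  refine (re_trace_mul_le A B).trans ?_
  have h1 : Real.sqrt (hsNormSq A) ≤ A.trace.re := by
    rw [← Real.sqrt_sq (re_trace_nonneg_of_posSemidef hA)]
    exact Real.sqrt_le_sqrt (hsNormSq_le_sq_trace_of_posSemidef hA)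
  have h2 : Real.sqrt (hsNormSq B) ≤ B.trace.re := by
    rw [← Real.sqrt_sq (re_trace_nonneg_of_posSemidef hB)]
    exact Real.sqrt_le_sqrt (hsNormSq_le_sq_trace_of_posSemidef hB)
  exact mul_le_mul h1 h2 (Real.sqrt_nonneg _) (re_trace_nonneg_of_posSemidef hA)

end HilbertSchmidt

/-! ### Kraus maps -/

section Kraus

variable {ι : Type*} [Fintype ι]

/-- The completely positive map `X ↦ Σᵢ Kᵢ X Kᵢ†` given by Kraus operators `K`.
[cite: KempeEtAl2010, §1 (Our model: arbitrary one-qubit gates) and Lemma 8] -/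
def krausMap (K : ι → Matrix n n ℂ) (X : Matrix n n ℂ) : Matrix n n ℂ :=
  ∑ i, K i * X * (K i)ᴴ

/-- `krausMap` is additive. [folklore] -/
theorem krausMap_add (K : ι → Matrix n n ℂ) (X Y : Matrix n n ℂ) :
    krausMap K (X + Y) = krausMap K X + krausMap K Y := by
  simp only [krausMap, mul_add, add_mul, Finset.sum_add_distrib]

/-- `krausMap` commutes with scalars. [folklore] -/
theorem krausMap_smul (K : ι → Matrix n n ℂ) (c : ℂ) (X : Matrix n n ℂ) :
    krausMap K (c • X) = c • krausMap K X := by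
  simp only [krausMap, mul_smul_comm, smul_mul_assoc, Finset.smul_sum]

/-- `krausMap` of zero. [folklore] -/
theorem krausMap_zero (K : ι → Matrix n n ℂ) : krausMap K 0 = 0 := by
  simp [krausMap]

/-- `krausMap` is subtractive. [folklore] -/
theorem krausMap_sub (K : ι → Matrix n n ℂ) (X Y : Matrix n n ℂ) :
    krausMap K (X - Y) = krausMap K X - krausMap K Y := by
  simp only [krausMap, mul_sub, sub_mul, Finset.sum_sub_distrib]

/-- `krausMap` commutes with finite sums. [folklore] -/
theorem krausMap_sum {κ : Type*} (K : ι → Matrix n n ℂ) (s : Finset κ) (X : κ → Matrix n n ℂ) :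
    krausMap K (∑ k ∈ s, X k) = ∑ k ∈ s, krausMap K (X k) := by
  simp only [krausMap, Finset.mul_sum, Finset.sum_mul]
  rw [Finset.sum_comm]

/-- `krausMap` as a `ℂ`-linear map. [folklore] -/
def krausMapL (K : ι → Matrix n n ℂ) : Matrix n n ℂ →ₗ[ℂ] Matrix n n ℂ where
  toFun := krausMap K
  map_add' := krausMap_add K
  map_smul' := krausMap_smul K

/-- Unfolding of `krausMapL`. [folklore] -/
@[simp] theorem krausMapL_apply (K : ι → Matrix n n ℂ) (X : Matrix n n ℂ) :
    krausMapL K X = krausMap K X := rfl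

/-- `(Σ Kᵢ X Kᵢ†)† = Σ Kᵢ X† Kᵢ†`. [folklore] -/
theorem conjTranspose_krausMap (K : ι → Matrix n n ℂ) (X : Matrix n n ℂ) :
    (krausMap K X)ᴴ = krausMap K Xᴴ := by
  simp only [krausMap, conjTranspose_sum, conjTranspose_mul, conjTranspose_conjTranspose,
    Matrix.mul_assoc]

/-- Kraus maps preserve hermiticity. [folklore] -/
theorem isHermitian_krausMap {X : Matrix n n ℂ} (hX : X.IsHermitian) (K : ι → Matrix n n ℂ) :
    (krausMap K X).IsHermitian := by
  rw [IsHermitian, conjTranspose_krausMap, hX.eq]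

/-- Kraus maps preserve positivity. [folklore] -/
theorem posSemidef_krausMap {X : Matrix n n ℂ} (hX : X.PosSemidef) (K : ι → Matrix n n ℂ) :
    (krausMap K X).PosSemidef :=
  posSemidef_sum _ fun i _ => hX.mul_mul_conjTranspose_same (K i)

/-- Trace preservation: `Σ Kᵢ† Kᵢ = 1` implies `Tr(Σ Kᵢ X Kᵢ†) = Tr X`.
[cite: KempeEtAl2010, §1 (completely-positive trace-preserving one-qubit gates)] -/
theorem trace_krausMap [DecidableEq n] {K : ι → Matrix n n ℂ} (hK : ∑ i, (K i)ᴴ * K i = 1)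
    (X : Matrix n n ℂ) : (krausMap K X).trace = X.trace := by
  unfold krausMap
  rw [trace_sum]
  simp_rw [trace_mul_cycle (K _) X]
  rw [← trace_sum, ← Finset.sum_mul, hK, Matrix.one_mul]

end Kraus

end Literature.Computability.QuantumComplexity
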